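import Literature.Dynamics.Billiards.InfiniteUnstablePlaques
import HarnessLib

/-!
# Contact-slaved unstable plaques of the infinite hard-sphere flow (route UGibbsSRBRigidity, D5)

Topic `Literature/Dynamics/Billiards`; definition item `defn-SlavedUnstablePlaques` (request D5 of
route `Summits/AtomisticToContinuum/HydrodynamicLimit/Theses/UGibbsSRBRigidity.lean`; consumers: the
cruxes URegularLimitsSlaved / URigiditySlaved and the support item `PlaqueSanity slavedUnstablePlaques`).
This is the CONTACT-SLAVED re-posing of `Literature.Dynamics.Billiards.infiniteUnstablePlaques`
(item D4, file `InfiniteUnstablePlaques`), requested after the crux attack on URigidityR2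
(stmt-AtomisticToContinuum-13896) showed that D4's window dynamics is degenerate: there the exterior
particles are held to the recorded movie INCLUDING their recoils off window particles, applied on the
clock, so a window particle reaching a recorded window–exterior contact late by any `δ > 0` misses
its partner (which has already recoiled) and keeps an `O(1)` velocity error; the recorded orbit sits
on that discontinuity at each of its infinitely many exterior contacts and the plaques collapse to
leaf-null sets. Here the exterior is SLAVED TO ACTUAL CONTACTS instead (the planner's rendering β):
early or late, a window–exterior interaction happens at the actual contact, by one rule, and the
window dynamics has no discontinuity on the recorded orbit (`SlavedUnstablePlaquesNoGhost`).

## Contents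

1. **The clock and the events of an exterior particle**: `clockInstants ε W S rec q` (instants at
   which the RECORDED path of `q` touches another EXTERIOR particle — where the record of `q` jumps
   by an exterior–exterior impulse), `windowContactInstants ε W z q` (ACTUAL contacts of `q` with a
   window particle), `exteriorEvents` (their union).
2. **Slaved window trajectories** `IsSlavedTrajectory ε W S rec z` (reversed time `s ≥ 0`, all
   conventions of D4's `IsWindowTrajectory`: LEFT-continuous velocities, free flight anchored at
   right endpoints, outgoing velocities as right limits). `z q : ℝ → ℝ^d × ℝ^d` is the ACTUAL path of
   every label `q ∈ S`, `rec q` its recorded (reversed) path. The WINDOW clauses are exactly D4's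
   `IsWindowTrajectory ε W S z` (the structure is extended): hard core of window particles against
   all of `S`, finitely many window contacts in bounded times, continuous positions, free flight,
   and at every ACTUAL contact of a window particle `p` with any `q ∈ S` the one-sided elastic law
   `(reflectVel (x_p - x_q) (v_p, v_q)).1` fed with `q`'s CURRENT velocity. The ONE CHANGE is the
   exterior: an exterior particle `q ∈ S \ W` starts from its recorded datum `z q 0 = rec q 0`, has
   continuous position, flies freely between its events, and its velocity jumps are EXACTLY
   (i) the recorded exterior–exterior impulses ON THE CLOCK (`ext_clock`: at a clock instant `s` the
   right limit of `v_q` is `v_q(s) + (rec⁺_q(s) - rec_q(s))`, the recorded jump, applied whatever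
   `q`'s actual position) and (ii) the ELASTIC response `(reflectVel (x_q - x_p) (v_q, v_p)).1` at
   every ACTUAL contact with a window particle `p` (`ext_contact`). The recorded recoils of `q` off
   window particles are DROPPED from the clock (they are not clock instants); actual
   exterior–exterior contacts are ignored (no hard core, no response).
3. **Plaques**: `slavedUnstableSet Φ Λ ω` / `slavedLocalUnstableSet Φ Λ δ ω` — D4's carrier VERBATIM
   (good `ω` only; window labels `windowLabels Λ ω`; record `revTraj Φ ω`; exponential convergence
   of the WINDOW paths to the reversed recorded window paths; `implant` of the reversed time-`0`
   window data) with `IsSlavedTrajectory` in place of `IsWindowTrajectory ∘ gluePaths`; plaque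
   families `slavedWindowPlaques Φ Λ`, `slavedWindowLocalPlaques Φ Λ δ` with D4's leaf measure
   `windowLeafMeasure Φ Λ ω` (push-forward under `implant` of `μH[dk]` on the window data, zero off
   the good set and on empty windows); the functor
   `slavedUnstablePlaques ε Φ : PlaqueFamily (PointConfig (ℝ^d × ℝ^d))`, plaque
   `⋃ₙ slavedUnstableSet Φ (closedBall 0 (n+1)) ω`, leaf measure `Measure.sum` of the window leaf
   measures — the SAME leaf measures as D4's functor
   (`slavedUnstablePlaques_leafMeasure_eq`).
4. **Proved API** (acceptance lemmas (C), (L), (N) of the request; (T) is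
   `plaqueTeeth_slavedUnstablePlaques` in `SlavedUnstablePlaquesTeeth`, (G) is
   `SlavedUnstablePlaquesNoGhost`; (S) stays the predicate `PlaqueSanity`, not asserted):
   * junk values `slavedUnstableSet_eq_empty`, `slavedUnstablePlaques_plaque_eq_empty`,
     `slavedUnstablePlaques_leafMeasure_eq_zero`, `isURegular_slavedUnstablePlaques_iff_eq_zero`;
   * (L) LOCALITY `exterior_subset_of_mem_slavedUnstableSet`, `finite_diff_of_mem_slavedUnstableSet`;
   * MONOTONICITY `IsURegular.of_slavedWindowLocalPlaques`, `IsURegular.of_slavedWindowPlaques`;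
   * (C) CONSISTENCY `isSlavedTrajectory_reversePath` (the reversed recorded paths of ANY solution of
     the infinite equations of motion form a slaved trajectory for every finite window: on the
     record, actual contacts are recorded contacts, so clock instants and window contacts together
     are all recorded contacts of an exterior particle, and the prescribed jumps are the recorded
     ones), hence `self_mem_slavedUnstableSet`, `self_mem_slavedUnstablePlaques_plaque`
     (`ω ∈ W(ω)` for good `ω`, `ε > 0`);
   * (N) NO ATOMS `slavedUnstablePlaques_leafMeasure_setOf_coe_subset_eq_zero`,
     `slavedUnstablePlaques_leafMeasure_singleton` (`d ≥ 1`; inherited from D4's leaf measures).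

## Design choices

* *Clock instants are recorded GEOMETRIC contacts with an exterior partner.* For a genuine record
  (`revTraj Φ ω`, `ω` good) these are exactly the instants where the record of `q` jumps with an
  exterior partner (non-grazing binary collisions); the recorded jump is fed in through the right
  limit of the recorded velocity (`ext_clock` is an implication from that right limit, which exists
  for genuine records; no partial "jump function" is introduced).
* *Coincidences are over-determined, not arbitrated.* If a clock instant of `q` is also an actual
  window contact of `q`, or `q` touches two window particles at once, both prescriptions apply; data
  for which they conflict carry no slaved trajectory. On the recorded orbit this never happens
  (collisions of a solution are binary), and off it it is the usual codimension-one singularity of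
  a billiard, harmless for plaques defined up to leaf-null sets — unlike D4's discontinuity, which
  sat on the recorded orbit itself.
* *Fallback α not taken.* The admissible alternative of the request (at an actual window contact
  `q` takes its `j`-th RECORDED window recoil) is not used: rendering β (elastic response with the
  current velocities) is stated, so that the window particle and its partner obey one and the same
  two-body elastic law at the actual contact (`reflectVel_neg`, `reflectVel_swap`).
* Everything else — reversed time, one-sided law for window particles, `dk`-dimensional Hausdorff
  leaf measures transported by `implant`, aggregation over ball windows, no measurability claimed
  for plaques — is D4's, see the module docstring of `InfiniteUnstablePlaques`. Known caveats
  recorded by the planner (D5-design.md): the window plaques are not nested in the window and not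
  flow-invariant; neither property is used by `PlaqueFamily.IsURegular`.
* NOT CLAIMED: existence or dimension of slaved unstable manifolds beyond the recorded orbit itself,
  positivity of leaf measures of plaques, SANITY (route support item `PlaqueSanity
  slavedUnstablePlaques`), teeth for laminar / periodised states.

## References (templates; the object itself is posited by the route)

* F. Ledrappier, L.-S. Young, *The metric entropy of diffeomorphisms I*, Ann. Math. 122 (1985),
  (1.2) p. 512, Def. 1.4.1–1.4.2 p. 513 [LedrappierYoung1985].
* A. Katok, J.-M. Strelcyn, F. Ledrappier, F. Przytycki, *Invariant manifolds, entropy and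
  billiards; smooth maps with singularities*, LNM 1222 (1986), Parts II–III [KatokEtAl1986].
* G. Keller, C. Liverani, *Map lattices coupled by collisions*, CMP 291 (2009) (finite windows in
  an infinite lattice of colliding units) [KellerLiverani2009].
* N. Chernov, D. Dolgopyat, *Brownian Brownian motion I*, Mem. AMS 198 (2009) (a tagged particle
  elastically coupled to an environment of movers) [ChernovDolgopyat2009].
* M. Stenlund, L.-S. Young, H. Zhang, *Dispersing billiards with moving scatterers*, CMP 322
  (2013) (unstable curves of NON-AUTONOMOUS billiard dynamics) [StenlundYoungZhang2013].
* R. Alexander, *Time evolution for infinitely many hard spheres*, CMP 49 (1976) [Alexander1976].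
-/

noncomputable section

open MeasureTheory Set Filter Metric Function Topology
open scoped ENNReal NNReal InnerProductSpace
open Literature.Analysis.FunctionSpaces Literature.Analysis.FluidPDE

namespace Literature.Dynamics.Billiards

variable {d : Type*} [Fintype d]

local notation "𝔼" => EuclideanSpace ℝ d
local notation "𝕏" => EuclideanSpace ℝ d × EuclideanSpace ℝ d

/-! ## 1. The clock and the events of an exterior particle -/

omit [Fintype d] in
/-- The **clock instants** of the label `q` for the window `W ⊆ S` and the record `rec`: the
instants at which the RECORDED path of `q` is in contact with the recorded path of another
EXTERIOR label `q' ∈ S \ W` — for a genuine record, the instants at which the record of `q` jumps by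
an exterior–exterior impulse. Recorded contacts of `q` with WINDOW labels are deliberately not clock
instants (those recoils are dropped from the clock). Route-posited (D5, rendering β). [folklore] -/
def clockInstants (ε : ℝ) (W S : Set 𝕏) (rec : 𝕏 → ℝ → 𝕏) (q : 𝕏) : Set ℝ :=
  {s | ∃ q' ∈ S, q' ∉ W ∧ q' ≠ q ∧ ‖(rec q s).1 - (rec q' s).1‖ = ε}

/-- Membership in the clock instants. [folklore] -/
theorem mem_clockInstants_iff {ε : ℝ} {W S : Set 𝕏} {rec : 𝕏 → ℝ → 𝕏} {q : 𝕏} {s : ℝ} :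
    s ∈ clockInstants ε W S rec q ↔
      ∃ q' ∈ S, q' ∉ W ∧ q' ≠ q ∧ ‖(rec q s).1 - (rec q' s).1‖ = ε :=
  Iff.rfl

omit [Fintype d] in
/-- The **window-contact instants** of the label `q` along the ACTUAL paths `z`: the instants at
which `q` touches a window particle. Route-posited (D5). [folklore] -/
def windowContactInstants (ε : ℝ) (W : Set 𝕏) (z : 𝕏 → ℝ → 𝕏) (q : 𝕏) : Set ℝ :=
  {s | ∃ p ∈ W, ‖(z q s).1 - (z p s).1‖ = ε}

/-- Membership in the window-contact instants. [folklore] -/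
theorem mem_windowContactInstants_iff {ε : ℝ} {W : Set 𝕏} {z : 𝕏 → ℝ → 𝕏} {q : 𝕏} {s : ℝ} :
    s ∈ windowContactInstants ε W z q ↔ ∃ p ∈ W, ‖(z q s).1 - (z p s).1‖ = ε :=
  Iff.rfl

omit [Fintype d] in
/-- The **events of an exterior particle** `q` in the contact-slaved window dynamics: its clock
instants (recorded exterior–exterior impulses) and its actual contacts with window particles. Its
velocity may jump only there; actual exterior–exterior contacts are NOT events. Route-posited (D5).
[folklore] -/
def exteriorEvents (ε : ℝ) (W S : Set 𝕏) (rec z : 𝕏 → ℝ → 𝕏) (q : 𝕏) : Set ℝ :=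
  clockInstants ε W S rec q ∪ windowContactInstants ε W z q

/-- Membership in the exterior events. [folklore] -/
theorem mem_exteriorEvents_iff {ε : ℝ} {W S : Set 𝕏} {rec z : 𝕏 → ℝ → 𝕏} {q : 𝕏} {s : ℝ} :
    s ∈ exteriorEvents ε W S rec z q ↔
      s ∈ clockInstants ε W S rec q ∨ s ∈ windowContactInstants ε W z q :=
  Iff.rfl

/-- With no exterior label other than `q` there is no clock instant. [folklore] -/
theorem clockInstants_eq_empty {ε : ℝ} {W S : Set 𝕏} {rec : 𝕏 → ℝ → 𝕏} {q : 𝕏}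
    (h : ∀ q' ∈ S, q' ∉ W → q' = q) : clockInstants ε W S rec q = ∅ :=
  eq_empty_of_forall_notMem fun _ ⟨q', hq'S, hq'W, hq'q, _⟩ => hq'q (h q' hq'S hq'W)

/-! ## 2. Slaved window trajectories (reversed time, contact-slaved exterior) -/

/-- **Contact-slaved window trajectory** (the window dynamics of route UGibbsSRBRigidity, request
D5, rendering β; REVERSED time `s ≥ 0`). `z q : ℝ → ℝ^d × ℝ^d` is the actual path of the label
`q ∈ S`, `rec q` its recorded path; `W ⊆ S` is the window. The WINDOW clauses are those of
`IsWindowTrajectory ε W S z` (extended structure; D4): hard core of window particles against every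
other particle at all `s ≥ 0`, finitely many window contacts in bounded times, continuous window
positions, free flight anchored at right endpoints (LEFT-continuous velocities), and at every actual
contact of a window particle `p` with any `q ∈ S` a unique partner, non-grazing incoming velocities
and the one-sided elastic law `(reflectVel (x_p - x_q) (v_p, v_q)).1` with `q`'s CURRENT velocity.
The EXTERIOR clauses (the change with respect to D4, where exterior paths were the recorded ones):
an exterior particle `q ∈ S \ W` starts from its recorded datum, has continuous position, flies
freely on every interval `[σ, b)` free of its events (`exteriorEvents`: clock instants and actual
window contacts), takes at every clock instant the RECORDED velocity jump (right limit of the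
recorded velocity minus its current recorded value, added to its own current velocity — whatever its
actual position), and responds ELASTICALLY, by `(reflectVel (x_q - x_p) (v_q, v_p)).1` with the
current velocities, at every actual contact with a window particle `p`; together with `p`'s clause
this is the full two-body elastic law at that contact. No hard core and no response between exterior
particles. No published source defines this object (route-posited); templates: frozen / driven
environments of a finite subsystem in Keller–Liverani 2009, Chernov–Dolgopyat 2009, and the
non-autonomous billiards of Stenlund–Young–Zhang 2013. [folklore] -/
structure IsSlavedTrajectory (ε : ℝ) (W S : Set 𝕏) (rec z : 𝕏 → ℝ → 𝕏) : Prop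
    extends IsWindowTrajectory ε W S z where
  /-- Exterior particles start from their recorded data. -/
  ext_zero : ∀ q ∈ S, q ∉ W → z q 0 = rec q 0
  /-- Positions of exterior particles are continuous on `[0, ∞)`. -/
  ext_pos_continuous : ∀ q ∈ S, q ∉ W → ContinuousOn (fun s => (z q s).1) (Ici 0)
  /-- Free flight of exterior particles between their events, anchored at the right endpoint. -/
  ext_free : ∀ q ∈ S, q ∉ W → ∀ σ b : ℝ, 0 ≤ σ → σ ≤ b →
    (∀ τ ∈ Ico σ b, τ ∉ exteriorEvents ε W S rec z q) →
      z q σ = ((z q b).1 + (σ - b) • (z q b).2, (z q b).2)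
  /-- At a clock instant an exterior particle takes the RECORDED velocity jump: if the recorded
  velocity has the right limit `w` at `s`, the actual velocity has the right limit
  `v_q(s) + (w - rec_q(s))`. -/
  ext_clock : ∀ q ∈ S, q ∉ W → ∀ s : ℝ, 0 ≤ s → s ∈ clockInstants ε W S rec q →
    ∀ w : 𝔼, Tendsto (fun σ => (rec q σ).2) (𝓝[>] s) (𝓝 w) →
      Tendsto (fun σ => (z q σ).2) (𝓝[>] s) (𝓝 ((z q s).2 + (w - (rec q s).2)))
  /-- At an actual contact with a window particle an exterior particle responds elastically (its
  outgoing velocity, a right limit, is given by the elastic law with the current velocities). -/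
  ext_contact : ∀ q ∈ S, q ∉ W → ∀ p ∈ W, ∀ s : ℝ, 0 ≤ s → ‖(z q s).1 - (z p s).1‖ = ε →
    Tendsto (fun σ => (z q σ).2) (𝓝[>] s)
      (𝓝 (reflectVel ((z q s).1 - (z p s).1) ((z q s).2, (z p s).2)).1)

/-! ## 3. Slaved unstable sets, plaque families and the functor -/

variable {ε : ℝ}

/-- The **contact-slaved unstable set of `ω` for the window `Λ`** under the infinite hard-sphere
flow `Φ` (route-posited, D5; the analogue of Ledrappier–Young's (1.2)
`W^u(x) = {y | d(f⁻ⁿ y, f⁻ⁿ x) → 0 exponentially}` for the slaved window system): the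
configurations obtained from a GOOD `ω` by replacing the phase points of its finitely many particles
in `Λ × ℝ^d` by the (reversed) time-`0` window data of a slaved trajectory — window labels
`windowLabels Λ ω`, all labels `ω`, record `revTraj Φ ω` — whose WINDOW paths converge
exponentially fast, in phase space and particle by particle, to the reversed recorded window paths.
D4's carrier with the contact-slaved dynamics; empty if `ω ∉ Φ.good`.
[cite: LedrappierYoung1985, (1.2) p. 512] -/
def slavedUnstableSet (Φ : InfiniteHardSphereFlow d ε) (Λ : Set 𝔼) (ω : PointConfig 𝕏) :
    Set (PointConfig 𝕏) :=
  {ω' | ω ∈ Φ.good ∧ ∃ z : 𝕏 → ℝ → 𝕏,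
    IsSlavedTrajectory ε (windowLabels Λ ω : Set 𝕏) (ω : Set 𝕏) (revTraj Φ ω) z ∧
      (∃ r : ℝ, 0 < r ∧ ∀ᶠ s : ℝ in atTop, ∀ p ∈ windowLabels Λ ω,
        dist (z p s) (revTraj Φ ω p s) ≤ Real.exp (-(r * s))) ∧
      ω' = implant Λ ω (fun p : ↥(windowLabels Λ ω) => revPhase (z p 0))}

/-- The **local contact-slaved unstable set of size `δ`**: as `slavedUnstableSet`, the window paths
staying moreover `δ`-close to the recorded ones at all `s ≥ 0` (Ledrappier–Young's `W^u_δ`).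
[cite: LedrappierYoung1985, (1.2) p. 512] -/
def slavedLocalUnstableSet (Φ : InfiniteHardSphereFlow d ε) (Λ : Set 𝔼) (δ : ℝ)
    (ω : PointConfig 𝕏) : Set (PointConfig 𝕏) :=
  {ω' | ω ∈ Φ.good ∧ ∃ z : 𝕏 → ℝ → 𝕏,
    IsSlavedTrajectory ε (windowLabels Λ ω : Set 𝕏) (ω : Set 𝕏) (revTraj Φ ω) z ∧
      (∃ r : ℝ, 0 < r ∧ ∀ᶠ s : ℝ in atTop, ∀ p ∈ windowLabels Λ ω,
        dist (z p s) (revTraj Φ ω p s) ≤ Real.exp (-(r * s))) ∧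
      (∀ s : ℝ, 0 ≤ s → ∀ p ∈ windowLabels Λ ω, dist (z p s) (revTraj Φ ω p s) ≤ δ) ∧
      ω' = implant Λ ω (fun p : ↥(windowLabels Λ ω) => revPhase (z p 0))}

/-- The **contact-slaved window-`Λ` plaque family**: plaque `slavedUnstableSet Φ Λ ω`, leaf measure
D4's `windowLeafMeasure Φ Λ ω` (the `dk`-dimensional Hausdorff measure on the window data transported
by `implant`; zero off the good set and on empty windows). [cite: LedrappierYoung1985, (1.2) p. 512] -/
def slavedWindowPlaques (Φ : InfiniteHardSphereFlow d ε) (Λ : Set 𝔼) :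
    PlaqueFamily (PointConfig 𝕏) where
  plaque := slavedUnstableSet Φ Λ
  leafMeasure := windowLeafMeasure Φ Λ

/-- The **local** contact-slaved window-`Λ` plaque family of size `δ`.
[cite: LedrappierYoung1985, (1.2) p. 512] -/
def slavedWindowLocalPlaques (Φ : InfiniteHardSphereFlow d ε) (Λ : Set 𝔼) (δ : ℝ) :
    PlaqueFamily (PointConfig 𝕏) where
  plaque := slavedLocalUnstableSet Φ Λ δ
  leafMeasure := windowLeafMeasure Φ Λ

/-- **The contact-slaved unstable-plaque functor of the infinite hard-sphere flow** (definition
request `defn-SlavedUnstablePlaques`, D5 of route UGibbsSRBRigidity; the requested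
`L : (ε : ℝ) → InfiniteHardSphereFlow d ε → PlaqueFamily (PointConfig (ℝ^d × ℝ^d))`): plaque through
`ω` = the union over the ball windows `Λ_n = closedBall 0 (n+1)` of the slaved window unstable sets,
leaf measure = the sum of D4's window leaf measures (a countable union of finite-dimensional
sub-plaques, each with the Hausdorff measure of its own full unstable dimension `dk`; only null sets
enter `PlaqueFamily.IsURegular`). Same carrier and leaf measures as `infiniteUnstablePlaques`; only
the window dynamics differs (contact-slaved exterior). [cite: LedrappierYoung1985, (1.2) p. 512] -/
def slavedUnstablePlaques (ε : ℝ) (Φ : InfiniteHardSphereFlow d ε) :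
    PlaqueFamily (PointConfig 𝕏) where
  plaque ω := ⋃ n : ℕ, slavedUnstableSet Φ (closedBall (0 : 𝔼) (n + 1)) ω
  leafMeasure ω := Measure.sum fun n : ℕ => windowLeafMeasure Φ (closedBall (0 : 𝔼) (n + 1)) ω

/-! ## 4. Basic properties: junk values, locality, monotonicity -/

section Basic

variable {Φ : InfiniteHardSphereFlow d ε} {Λ : Set (EuclideanSpace ℝ d)} {δ : ℝ}
  {ω ω' : PointConfig (EuclideanSpace ℝ d × EuclideanSpace ℝ d)}

/-- A slaved trajectory is in particular a window trajectory in the sense of D4 (for the actual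
paths of all particles). [folklore] -/
theorem IsSlavedTrajectory.isWindowTrajectory {W S : Set 𝕏} {rec z : 𝕏 → ℝ → 𝕏}
    (h : IsSlavedTrajectory ε W S rec z) : IsWindowTrajectory ε W S z :=
  h.toIsWindowTrajectory

/-- Off the good set the slaved unstable set is empty. [folklore] -/
theorem slavedUnstableSet_eq_empty (h : ω ∉ Φ.good) : slavedUnstableSet Φ Λ ω = ∅ :=
  eq_empty_of_forall_notMem fun _ h' => h h'.1

/-- Members of a slaved unstable set come from good configurations. [folklore] -/
theorem mem_good_of_mem_slavedUnstableSet (h : ω' ∈ slavedUnstableSet Φ Λ ω) : ω ∈ Φ.good :=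
  h.1

/-- Local slaved unstable sets are contained in the slaved unstable set. [folklore] -/
theorem slavedLocalUnstableSet_subset :
    slavedLocalUnstableSet Φ Λ δ ω ⊆ slavedUnstableSet Φ Λ ω := by
  rintro ω' ⟨hω, z, hz, hconv, -, hω'⟩
  exact ⟨hω, z, hz, hconv, hω'⟩

/-- **(L) Locality**: a configuration in the slaved window-`Λ` unstable set of `ω` contains every
particle of `ω` outside the window … [folklore] -/
theorem exterior_subset_of_mem_slavedUnstableSet (h : ω' ∈ slavedUnstableSet Φ Λ ω) :
    (ω : Set 𝕏) ∩ Prod.fst ⁻¹' Λᶜ ⊆ (ω' : Set 𝕏) := by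
  obtain ⟨-, z, -, -, rfl⟩ := h
  rw [coe_implant]
  exact subset_union_left

/-- … and only finitely many particles that are not particles of `ω` (so `plaque = univ` is
excluded). [folklore] -/
theorem finite_diff_of_mem_slavedUnstableSet (h : ω' ∈ slavedUnstableSet Φ Λ ω) :
    ((ω' : Set 𝕏) \ (ω : Set 𝕏)).Finite := by
  obtain ⟨-, z, -, -, rfl⟩ := h
  rw [coe_implant]
  refine (finite_range fun p : ↥(windowLabels Λ ω) => revPhase (z p 0)).subset ?_
  rintro p ⟨hp | hp, hp'⟩
  · exact absurd hp.1 hp'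
  · exact hp

/-- Unfolding lemma: the plaques of the functor. [folklore] -/
@[simp]
theorem slavedUnstablePlaques_plaque (Φ : InfiniteHardSphereFlow d ε) (ω : PointConfig 𝕏) :
    (slavedUnstablePlaques ε Φ).plaque ω =
      ⋃ n : ℕ, slavedUnstableSet Φ (closedBall (0 : 𝔼) (n + 1)) ω :=
  rfl

/-- Unfolding lemma: the leaf measures of the functor. [folklore] -/
@[simp]
theorem slavedUnstablePlaques_leafMeasure (Φ : InfiniteHardSphereFlow d ε) (ω : PointConfig 𝕏) :
    (slavedUnstablePlaques ε Φ).leafMeasure ω =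
      Measure.sum fun n : ℕ => windowLeafMeasure Φ (closedBall (0 : 𝔼) (n + 1)) ω :=
  rfl

/-- The functor has the SAME leaf measures as D4's `infiniteUnstablePlaques` (only the plaques
changed). [folklore] -/
theorem slavedUnstablePlaques_leafMeasure_eq (Φ : InfiniteHardSphereFlow d ε) :
    (slavedUnstablePlaques ε Φ).leafMeasure = (infiniteUnstablePlaques ε Φ).leafMeasure :=
  rfl

/-- Unfolding lemma. [folklore] -/
@[simp]
theorem slavedWindowPlaques_plaque (Φ : InfiniteHardSphereFlow d ε) (Λ : Set 𝔼)
    (ω : PointConfig 𝕏) : (slavedWindowPlaques Φ Λ).plaque ω = slavedUnstableSet Φ Λ ω :=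
  rfl

/-- Unfolding lemma. [folklore] -/
@[simp]
theorem slavedWindowPlaques_leafMeasure (Φ : InfiniteHardSphereFlow d ε) (Λ : Set 𝔼)
    (ω : PointConfig 𝕏) : (slavedWindowPlaques Φ Λ).leafMeasure ω = windowLeafMeasure Φ Λ ω :=
  rfl

/-- Unfolding lemma. [folklore] -/
@[simp]
theorem slavedWindowLocalPlaques_plaque (Φ : InfiniteHardSphereFlow d ε) (Λ : Set 𝔼) (δ : ℝ)
    (ω : PointConfig 𝕏) :
    (slavedWindowLocalPlaques Φ Λ δ).plaque ω = slavedLocalUnstableSet Φ Λ δ ω :=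
  rfl

/-- Unfolding lemma. [folklore] -/
@[simp]
theorem slavedWindowLocalPlaques_leafMeasure (Φ : InfiniteHardSphereFlow d ε) (Λ : Set 𝔼) (δ : ℝ)
    (ω : PointConfig 𝕏) :
    (slavedWindowLocalPlaques Φ Λ δ).leafMeasure ω = windowLeafMeasure Φ Λ ω :=
  rfl

/-- Off the good set the plaque of the functor is empty. [folklore] -/
theorem slavedUnstablePlaques_plaque_eq_empty (Φ : InfiniteHardSphereFlow d ε) (h : ω ∉ Φ.good) :
    (slavedUnstablePlaques ε Φ).plaque ω = ∅ := by
  simp [slavedUnstableSet_eq_empty h]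

/-- Off the good set the leaf measure of the functor vanishes. [folklore] -/
theorem slavedUnstablePlaques_leafMeasure_eq_zero (Φ : InfiniteHardSphereFlow d ε)
    (h : ω ∉ Φ.good) : (slavedUnstablePlaques ε Φ).leafMeasure ω = 0 := by
  simp [windowLeafMeasure_of_notMem_good h]

/-- **Smaller plaques, stronger u-regularity**: a law u-regular for the LOCAL slaved window plaques
of some size is u-regular for the slaved window plaques. [folklore] -/
theorem _root_.Literature.Dynamics.Billiards.PlaqueFamily.IsURegular.of_slavedWindowLocalPlaques
    {μ : Measure (PointConfig 𝕏)} (h : (slavedWindowLocalPlaques Φ Λ δ).IsURegular μ) :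
    (slavedWindowPlaques Φ Λ).IsURegular μ := by
  intro s hs hnull
  refine h s hs ?_
  filter_upwards [hnull] with ω hω
  exact measure_mono_null (inter_subset_inter_right _ slavedLocalUnstableSet_subset) hω

/-- **One window suffices**: a law u-regular for the slaved plaques of one ball window
`closedBall 0 (n+1)` is u-regular for the functor. [folklore] -/
theorem _root_.Literature.Dynamics.Billiards.PlaqueFamily.IsURegular.of_slavedWindowPlaques
    {μ : Measure (PointConfig 𝕏)} (n : ℕ)
    (h : (slavedWindowPlaques Φ (closedBall (0 : 𝔼) (n + 1))).IsURegular μ) :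
    (slavedUnstablePlaques ε Φ).IsURegular μ := by
  intro s hs hnull
  refine h s hs ?_
  filter_upwards [hnull] with ω hω
  rw [slavedUnstablePlaques_leafMeasure, Measure.sum_apply_eq_zero] at hω
  exact measure_mono_null
    (inter_subset_inter_right _ (subset_iUnion (fun m : ℕ =>
      slavedUnstableSet Φ (closedBall (0 : 𝔼) (m + 1)) ω) n)) (hω n)

/-- **Teeth, zeroth form**: a law giving no mass to the good set of the flow is u-regular for the
functor only if it is zero. [folklore] -/
theorem isURegular_slavedUnstablePlaques_iff_eq_zero (Φ : InfiniteHardSphereFlow d ε)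
    {μ : Measure (PointConfig 𝕏)} (hμ : μ Φ.good = 0) :
    (slavedUnstablePlaques ε Φ).IsURegular μ ↔ μ = 0 := by
  refine ⟨fun h => ?_, fun h => h ▸ PlaqueFamily.isURegular_zero _⟩
  rw [← Measure.measure_univ_eq_zero]
  refine h univ MeasurableSet.univ ?_
  have hae : ∀ᵐ ω ∂μ, ω ∉ Φ.good := by
    rw [ae_iff]
    simpa only [not_not, setOf_mem_eq] using hμ
  filter_upwards [hae] with ω hω
  rw [slavedUnstablePlaques_plaque_eq_empty Φ hω, inter_empty, measure_empty]

end Basic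

/-! ## 5. (C) Consistency: reversed recorded paths are slaved trajectories; `ω ∈ W(ω)` -/

section Consistency

/-- **Consistency of the slaved window dynamics with the infinite dynamics**: for every solution
`x` of the infinite hard-sphere equations of motion with label set `S` and every finite window
`W ⊆ S`, the time-reversed paths `s ↦ R (x p (-s))`, taken both as the record and as the actual
paths, form a slaved trajectory. The window clauses are D4's `isWindowTrajectory_reversePath`; for
an exterior particle `q`, the same theorem for the finite window `{q}` supplies free flight between
its recorded contacts — each of which is a clock instant (exterior partner) or an actual window
contact (window partner) — and the elastic response at its window contacts; the clock clause is
tautological on the record (the prescribed right limit is the recorded one). [folklore] -/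
theorem isSlavedTrajectory_reversePath {W S : Set 𝕏} (hWS : W ⊆ S) (hW : W.Finite)
    {x : 𝕏 → ℝ → 𝕏} (hx : IsInfiniteHardSphereTrajectory ε S x) :
    IsSlavedTrajectory ε W S (fun p => reversePath (x p)) (fun p => reversePath (x p)) where
  toIsWindowTrajectory := isWindowTrajectory_reversePath hWS hW hx
  ext_zero _ _ _ := rfl
  ext_pos_continuous q hq _ := ((hx.pos_continuous q hq).comp continuous_neg).continuousOn
  ext_free q hq hqW σ b hσ hσb hfree := by
    have hq' : ({q} : Set 𝕏) ⊆ S := singleton_subset_iff.2 hq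
    refine (isWindowTrajectory_reversePath hq' (finite_singleton q) hx).free q rfl σ b hσ hσb
      fun τ hτ hev => ?_
    obtain ⟨-, q', hq'S, hq'q, hcontact⟩ := mem_collisionEvents.1 hev
    refine hfree τ hτ ?_
    by_cases hq'W : q' ∈ W
    · exact Or.inr ⟨q', hq'W, hcontact⟩
    · exact Or.inl ⟨q', hq'S, hq'W, hq'q, hcontact⟩
  ext_clock q _ _ s _ _ w hw := by
    rwa [add_sub_cancel]
  ext_contact q hq hqW p hp s hs hcontact := by
    have hq' : ({q} : Set 𝕏) ⊆ S := singleton_subset_iff.2 hq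
    have hqp : q ≠ p := fun h => hqW (h ▸ hp)
    exact ((isWindowTrajectory_reversePath hq' (finite_singleton q) hx).collision q rfl p
      (hWS hp) hqp s hs hcontact).2.2

variable {Φ : InfiniteHardSphereFlow d ε} {Λ : Set (EuclideanSpace ℝ d)}
  {ω : PointConfig (EuclideanSpace ℝ d × EuclideanSpace ℝ d)}

/-- The reversed recorded paths of a good configuration form a slaved trajectory for every bounded
window (record = actual paths). [folklore] -/
theorem isSlavedTrajectory_revTraj (hω : ω ∈ Φ.good) :
    IsSlavedTrajectory ε (windowLabels Λ ω : Set 𝕏) (ω : Set 𝕏) (revTraj Φ ω) (revTraj Φ ω) :=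
  isSlavedTrajectory_reversePath (windowLabels_subset Λ ω) (windowLabels Λ ω).finite_toSet
    (Φ.isTrajectory ω hω)

/-- **(C) Every good configuration lies on its own slaved window plaque** (for `ε > 0` and a
bounded window): the reversed recorded paths are a slaved trajectory converging to themselves, and
implanting the recorded window data gives back the configuration. [folklore] -/
theorem self_mem_slavedUnstableSet (hε : 0 < ε) (hΛ : Bornology.IsBounded Λ) (hω : ω ∈ Φ.good) :
    ω ∈ slavedUnstableSet Φ Λ ω := by
  have hfin : (particlesIn ω Λ).Finite :=
    ((Φ.good_subset hω).posLocallyFinite hε).finite_particlesIn hΛ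
  refine ⟨hω, revTraj Φ ω, isSlavedTrajectory_revTraj hω,
    ⟨1, one_pos, Eventually.of_forall fun s p _ => ?_⟩, ?_⟩
  · rw [dist_self]
    exact (Real.exp_pos _).le
  · conv_lhs => rw [← implant_self hfin]
    congr 1
    funext p
    rw [revTraj_apply, neg_zero, Φ.traj_zero ω hω p (windowLabels_subset Λ ω p.2),
      revPhase_revPhase]

/-- Every good configuration lies on its own LOCAL slaved window plaque of nonnegative size.
[folklore] -/
theorem self_mem_slavedLocalUnstableSet (hε : 0 < ε) (hΛ : Bornology.IsBounded Λ) {δ : ℝ}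
    (hδ : 0 ≤ δ) (hω : ω ∈ Φ.good) : ω ∈ slavedLocalUnstableSet Φ Λ δ ω := by
  have hfin : (particlesIn ω Λ).Finite :=
    ((Φ.good_subset hω).posLocallyFinite hε).finite_particlesIn hΛ
  refine ⟨hω, revTraj Φ ω, isSlavedTrajectory_revTraj hω,
    ⟨1, one_pos, Eventually.of_forall fun s p _ => ?_⟩, fun s _ p _ => ?_, ?_⟩
  · rw [dist_self]
    exact (Real.exp_pos _).le
  · rw [dist_self]
    exact hδ
  · conv_lhs => rw [← implant_self hfin]
    congr 1
    funext p
    rw [revTraj_apply, neg_zero, Φ.traj_zero ω hω p (windowLabels_subset Λ ω p.2),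
      revPhase_revPhase]

/-- **(C)** Every good configuration lies on its own plaque of the functor (`ε > 0`). [folklore] -/
theorem self_mem_slavedUnstablePlaques_plaque (hε : 0 < ε) (hω : ω ∈ Φ.good) :
    ω ∈ (slavedUnstablePlaques ε Φ).plaque ω :=
  mem_iUnion.2 ⟨0, self_mem_slavedUnstableSet hε isBounded_closedBall hω⟩

/-- The slaved window plaques of a good configuration are nonempty (`ε > 0`, bounded window).
[folklore] -/
theorem slavedUnstableSet_nonempty (hε : 0 < ε) (hΛ : Bornology.IsBounded Λ) (hω : ω ∈ Φ.good) :
    (slavedUnstableSet Φ Λ ω).Nonempty :=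
  ⟨ω, self_mem_slavedUnstableSet hε hΛ hω⟩

end Consistency

/-! ## 6. (N) No atoms: the leaf measures charge no countable family of particles -/

section NoAtoms

variable {Φ : InfiniteHardSphereFlow d ε}
  {ω : PointConfig (EuclideanSpace ℝ d × EuclideanSpace ℝ d)}

/-- The leaf measures of the functor charge no countable family of particles (`d ≥ 1`): the
configurations all of whose particles lie in a countable set are leaf-null (inherited from D4's
window leaf measures, `windowLeafMeasure_setOf_coe_subset_eq_zero`). [folklore] -/
theorem slavedUnstablePlaques_leafMeasure_setOf_coe_subset_eq_zero [Nonempty d]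
    (Φ : InfiniteHardSphereFlow d ε) (ω : PointConfig 𝕏) {C : Set 𝕏} (hC : C.Countable) :
    (slavedUnstablePlaques ε Φ).leafMeasure ω {ω' | (ω' : Set 𝕏) ⊆ C} = 0 := by
  rw [slavedUnstablePlaques_leafMeasure, Measure.sum_apply_eq_zero]
  exact fun n => windowLeafMeasure_setOf_coe_subset_eq_zero hC

/-- **(N) No Dirac leaves**: the leaf measures of the functor have no atoms (`d ≥ 1`). [folklore] -/
theorem slavedUnstablePlaques_leafMeasure_singleton [Nonempty d] (Φ : InfiniteHardSphereFlow d ε)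
    (ω ω' : PointConfig 𝕏) : (slavedUnstablePlaques ε Φ).leafMeasure ω {ω'} = 0 :=
  measure_mono_null (fun _ h => by rw [mem_singleton_iff.1 h]; exact fun _ hp => hp)
    (slavedUnstablePlaques_leafMeasure_setOf_coe_subset_eq_zero Φ ω
      (countable_coe_pointConfig ω'))

/-- The leaf measures of the slaved window plaques have no atoms (`d ≥ 1`; they are D4's window
leaf measures). [folklore] -/
theorem slavedWindowPlaques_leafMeasure_singleton [Nonempty d] (Φ : InfiniteHardSphereFlow d ε)
    (Λ : Set 𝔼) (ω ω' : PointConfig 𝕏) : (slavedWindowPlaques Φ Λ).leafMeasure ω {ω'} = 0 :=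
  windowLeafMeasure_singleton ω'

end NoAtoms

end Literature.Dynamics.Billiards
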